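import Literature.IUT.HodgeTheaters.GlobalFrobenioidsArithmeticClosers
import HarnessLib

/-!
# [IUTchI] Example 5.1 (i)→(ii): a GALOIS CHART of the reconstructed field `𝕄̄^⊛(†𝒟^⊚)` and the divisor data
# it induces on `†𝒟^⊛` (adapter from abc-iut-L5-t1's interface `NFBridgeRecon` to the arithmetic model)

Mochizuki, *Inter-universal Teichmüller theory I*, §5, Example 5.1 (i)–(ii), kurims manuscript (May 2020)
pp. 123–125 ([IUTchI] Ex 5.1 (i) p.123) [claim: Mochizuki2012, status: disputed]: "we may construct
group-theoretically from `π₁(†𝒟^⊚)` an isomorph of `F̄^×` — which we shall denote `𝕄^⊛(†𝒟^⊚)` — equipped with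
its natural `π₁(†𝒟^⊚)`-action … a profinite group corresponding to `C_{F_mod}` … together with a natural
extension of the action … to `π₁(†𝒟^⊛)`.  In particular, by taking `π₁(†𝒟^⊛)`-invariants, we obtain a
submonoid/subfield `𝕄^⊛_mod(†𝒟^⊚) ⊆ 𝕄^⊛(†𝒟^⊚)`, `𝕄̄^⊛_mod(†𝒟^⊚) ⊆ 𝕄̄^⊛(†𝒟^⊚)` corresponding to
`F^×_mod ⊆ F̄^×`, `F_mod ⊆ F̄`" (p. 123); and (ii) p. 125 (the divisor data on `†𝒟^⊛`).

abc-iut-L5-t1 typed the output of (i) as the INTERFACE `NFBridgeRecon` (`GlobalFrobenioids.lean`): a profinite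
`piDast = π₁(†𝒟^⊛)`, an abstract field `Fbar = 𝕄̄^⊛(†𝒟^⊚)` with smooth `π₁(†𝒟^⊛)`-action, and REAL definitions
`MbarMod`, `Mmod` (the invariants).  The arithmetic model of (ii) (`GlobalDivisorData.arithAlong`,
`GlobalFrobenioidsArithmeticPullback.lean`, abc-iut-w4-d050) is indexed by a continuous surjection
`ρ : π₁(†𝒟^⊛) ↠ G_F = Gal(F̄/F)` (`F` in the role of `F_mod`).  This file is the ADAPTER between the two:

* `NFBridgeRecon.GaloisChart N F` — the datum "an isomorph of `F̄` … with its natural `π₁(†𝒟^⊛)`-action":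
  a continuous surjection `ρ : π₁(†𝒟^⊛) ↠ G_F` and a ring isomorphism `𝕄̄^⊛(†𝒟^⊚) ≅ F̄` equivariant along `ρ`
  (explicit DATA recording print's "isomorph"; no Prop-valued fact);
* `GlobalDivisorData.ofChart c := arithAlong F c.ρ c.surjective` — the Example 5.1 (ii) divisor data on
  `†𝒟^⊛ = ℬ(π₁(†𝒟^⊛))⁰` determined by the chart, with ALL [FrdI] Thm 5.2 hypotheses discharged
  (`ofChart_hypotheses`) and "`ℱ^⊛(†𝒟^⊚)` is a [model] Frobenioid [of isotropic type]" UNCONDITIONAL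
  (`isFrobenioid_ofChart`, `isOfIsotropicType_ofChart`); `†ℱ^⊛`, `†ℱ^⊛_mod`, and `†ℱ^⊚` for
  `†𝒟^⊚ = ℬ(π₁(†𝒟^⊚))⁰` likewise (`GlobalFrobenioid.…_ofChart`);
* `NFBridgeRecon.GaloisChart.mem_mbarMod_iff` / `mem_mmod_iff` — (i)'s "corresponding to `F_mod ⊆ F̄`",
  "`F^×_mod ⊆ F̄^×`": through the chart, t1's REAL `MbarMod` / `Mmod` are EXACTLY the bottom field `F` /
  its non-zero elements (Krull's correspondence; abc-iut-w4-d050's `mem_mbarMod_iff_of_chart`).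

Universe note: the chart pins the interface's universe to `0`, where abc-iut-L1's number fields and `F̄` live.
"Stack-theoretic" caveat as in the companion files (Remark 3.1.5).  No new Prop fact; no statement of the paper is
strengthened; no side is taken on [IUTchIII] Cor. 3.12.
-/

noncomputable section

namespace Literature.IUT.HodgeTheaters

open CategoryTheory Opposite Literature.AlgebraicGeometry.Frobenioids
open Literature.AlgebraicGeometry.Frobenioids.QuasiTemperoid

namespace NFBridgeRecon

/-- **A Galois chart of the reconstructed field** ([IUTchI] Ex 5.1 (i), p. 123: "an isomorph of `F̄^×` …
equipped with its natural `π₁(†𝒟^⊚)`-action … [extended] to `π₁(†𝒟^⊛)`", the action factoring through "the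
quotient corresponding to the absolute Galois group of `F_mod`", p. 124): a continuous SURJECTION
`ρ : π₁(†𝒟^⊛) ↠ G_F = Gal(F̄/F)` (`F` in the role of `F_mod`) together with a ring isomorphism
`𝕄̄^⊛(†𝒟^⊚) ≅ F̄` that is `ρ`-equivariant.  DATA, not a fact. ([IUTchI] Ex 5.1 (i) p.123)
[claim: Mochizuki2012, status: disputed] -/
structure GaloisChart (N : NFBridgeRecon.{0}) (F : Type) [Field F] [NumberField F] : Type where
  /-- `π₁(†𝒟^⊛) ↠ G_{F_mod}` -/
  ρ : N.piDast →ₜ* QuasiTemperoid.GalFbar F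
  /-- … is surjective -/
  surjective : Function.Surjective ρ
  /-- `𝕄̄^⊛(†𝒟^⊚) ≅ F̄` -/
  iso : N.Fbar ≃+* QuasiTemperoid.Fbar F
  /-- … equivariantly along `ρ` -/
  iso_smul : ∀ (g : N.piDast) (x : N.Fbar), iso (g • x) = ρ g (iso x)

namespace GaloisChart

variable {N : NFBridgeRecon.{0}} {F : Type} [Field F] [NumberField F] (c : N.GaloisChart F)

/-- **Ex 5.1 (i): `𝕄̄^⊛_mod(†𝒟^⊚)` "corresponding to `F_mod ⊆ F̄`"** — through the chart, abc-iut-L5-t1's REAL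
`MbarMod` (the `π₁(†𝒟^⊛)`-invariants) is EXACTLY the bottom field `F ⊆ F̄`.
([IUTchI] Ex 5.1 (i) p.123) [claim: Mochizuki2012, status: disputed] -/
theorem mem_mbarMod_iff (x : N.Fbar) :
    x ∈ N.MbarMod ↔ c.iso x ∈ (⊥ : IntermediateField F (QuasiTemperoid.Fbar F)) :=
  N.mem_mbarMod_iff_of_chart F c.ρ.toMonoidHom c.surjective c.iso c.iso_smul x

/-- **Ex 5.1 (i): `𝕄^⊛_mod(†𝒟^⊚)` "corresponding to `F^×_mod ⊆ F̄^×`"** — through the chart, t1's REAL `Mmod`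
(the invariant non-zero elements) is exactly the set of non-zero elements of the bottom field `F`.
([IUTchI] Ex 5.1 (i) p.123) [claim: Mochizuki2012, status: disputed] -/
theorem mem_mmod_iff (x : N.Mast) :
    x ∈ N.Mmod ↔ c.iso (x : N.Fbar) ∈ (⊥ : IntermediateField F (QuasiTemperoid.Fbar F)) := by
  rw [← c.mem_mbarMod_iff]
  exact Iff.rfl

end GaloisChart

end NFBridgeRecon

/-! ### The divisor data of Example 5.1 (ii) determined by a chart -/

namespace GlobalDivisorData

variable {N : NFBridgeRecon.{0}} {F : Type} [Field F] [NumberField F] (c : N.GaloisChart F)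

/-- **[IUTchI] Ex 5.1 (ii) on `†𝒟^⊛ = ℬ(π₁(†𝒟^⊛))⁰` FROM THE (i)-DATA**: the divisor data
`(Φ^⊛(†𝒟^⊚), 𝔹, 𝕄^⊛(†𝒟^⊚)^A → Φ^⊛(A)^gp)` determined by a Galois chart of `𝕄̄^⊛(†𝒟^⊚)` — the pulled-back
arithmetic model `arithAlong` along the chart's `ρ : π₁(†𝒟^⊛) ↠ G_{F_mod}` ("arithmetic divisors on the
corresponding subfield `𝕄̄^⊛(†𝒟^⊚)^A`", [FrdI] Example 6.3 as typed by abc-iut-L1).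
([IUTchI] Ex 5.1 (ii) p.125) [claim: Mochizuki2012, status: disputed] -/
def ofChart : GlobalDivisorData N.piDast :=
  arithAlong F c.ρ c.surjective

/-- `ofChart` IS the pulled-back arithmetic model along the chart's quotient map.
([IUTchI] Ex 5.1 (ii) p.125) [claim: Mochizuki2012, status: disputed] -/
theorem ofChart_eq : ofChart c = arithAlong F c.ρ c.surjective := rfl

/-- ALL [FrdI] Thm 5.2 hypotheses hold for the chart's divisor data. ([IUTchI] Ex 5.1 (ii) p.125)
[claim: Mochizuki2012, status: disputed] -/
theorem ofChart_hypotheses : ModelFrobenioid.Hypotheses (ofChart c).Φ (ofChart c).B :=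
  arithAlong_hypotheses F c.ρ c.surjective

/-- **"this data determines, by applying [FrdI], Theorem 5.2, (ii), a model Frobenioid `ℱ^⊛(†𝒟^⊚)` over the base
category `†𝒟^⊛`" — UNCONDITIONAL for the data of a chart.** ([IUTchI] Ex 5.1 (ii) p.125)
[claim: Mochizuki2012, status: disputed] -/
theorem isFrobenioid_ofChart :
    PreFrobenioid.IsFrobenioid (ModelFrobenioid.toElem (ofChart c).Φ (ofChart c).B (ofChart c).div) :=
  isFrobenioid_arithAlong F c.ρ c.surjective

/-- … of isotropic type. ([IUTchI] Ex 5.1 (ii) p.125) [claim: Mochizuki2012, status: disputed] -/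
theorem isOfIsotropicType_ofChart :
    PreFrobenioid.IsOfIsotropicType (ModelFrobenioid.toElem (ofChart c).Φ (ofChart c).B (ofChart c).div) :=
  isOfIsotropicType_arithAlong F c.ρ c.surjective

/-- Ex 5.1 (iv)'s "`𝒪^×(A^birat)` … the multiplicative group of non-zero elements of the number field corresponding
to `A`" for the chart's data. ([IUTchI] Ex 5.1 (iv) p.126) [claim: Mochizuki2012, status: disputed] -/
theorem nonempty_rationalFunctionMonoidStr_ofChart :
    Nonempty (PreFrobenioid.RationalFunctionMonoidStr
      (ModelFrobenioid.toElem (ofChart c).Φ (ofChart c).B (ofChart c).div) (isFrobenioid_ofChart c)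
      (ofChart c).B (ofChart c).div) :=
  nonempty_rationalFunctionMonoidStr_arithAlong F c.ρ c.surjective

end GlobalDivisorData

/-! ### `†ℱ^⊛`, `†ℱ^⊛_mod`, `†ℱ^⊚` over the chart's data -/

namespace GlobalFrobenioid

variable {N : NFBridgeRecon.{0}} {F : Type} [Field F] [NumberField F] {c : N.GaloisChart F}
  {Dcirc : Type 1} [Category.{0} Dcirc] {toBase0 : Dcirc ⥤ BaseCat N.piDast}
  (𝓕 : GlobalFrobenioid (GlobalDivisorData.ofChart c) Dcirc toBase0)

/-- **Ex 5.1 (iii) "`†ℱ^⊛` is equipped with a natural Frobenioid structure" — UNCONDITIONAL over the chart's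
data.** ([IUTchI] Ex 5.1 (iii) p.125) [claim: Mochizuki2012, status: disputed] -/
theorem isFrobenioid_equivToElem_ofChart :
    PreFrobenioid.IsFrobenioid (𝓕.equiv.functor ⋙ ModelFrobenioid.toElem _ _ (GlobalDivisorData.ofChart c).div) :=
  𝓕.isFrobenioid_equivToElem_arithAlong

/-- **Ex 5.1 (iii) "`†ℱ^⊛_mod` … the Frobenioid of arithmetic line bundles on `S_mod`" IS a Frobenioid —
UNCONDITIONAL over the chart's data.** ([IUTchI] Ex 5.1 (iii) p.126) [claim: Mochizuki2012, status: disputed] -/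
theorem fmod_isFrobenioid_ofChart :
    ∃ e : 𝓕.Fmod ≌ PreFrobenioid.FiberProduct
        (𝓕.equiv.functor ⋙ ModelFrobenioid.toElem _ _ (GlobalDivisorData.ofChart c).div)
        (ObjectProperty.ι (fun X : BaseCat N.piDast => Nonempty (Limits.IsTerminal X))),
      (∀ A, (e.functor.obj A).fst = A.obj) ∧
      PreFrobenioid.IsFrobenioid (e.functor ⋙ PreFrobenioid.fiberProductFunctor
        (𝓕.equiv.functor ⋙ ModelFrobenioid.toElem _ _ (GlobalDivisorData.ofChart c).div)
        (ObjectProperty.ι (fun X : BaseCat N.piDast => Nonempty (Limits.IsTerminal X)))) :=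
  𝓕.fmod_isFrobenioid_arithAlong

end GlobalFrobenioid

/-- **Ex 5.1 (iii) "`†ℱ^⊚ := †ℱ^⊛|_{†𝒟^⊚}`" IS a Frobenioid — UNCONDITIONAL over the chart's data for
`†𝒟^⊚ = ℬ(π₁(†𝒟^⊚))⁰`** (`H = π₁(†𝒟^⊚)` any profinite group — e.g. t1's open subgroup `N.piDcirc` — and any
"natural morphism" `†𝒟^⊚ → †𝒟^⊛`). ([IUTchI] Ex 5.1 (iii) p.126) [claim: Mochizuki2012, status: disputed] -/
theorem GlobalFrobenioid.fcirc_isFrobenioid_ofChart {N : NFBridgeRecon.{0}} {F : Type} [Field F] [NumberField F]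
    {c : N.GaloisChart F} {H : ProfiniteGrp.{0}} {toBase0 : BaseCat H ⥤ BaseCat N.piDast}
    (𝓕 : GlobalFrobenioid (GlobalDivisorData.ofChart c) (BaseCat H) toBase0) :
    ∃ e : 𝓕.Fcirc ≌ PreFrobenioid.FiberProduct
        (𝓕.equiv.functor ⋙ ModelFrobenioid.toElem _ _ (GlobalDivisorData.ofChart c).div)
        (𝓕.baseMor ⋙ 𝓕.identify.functor),
      (∀ X, (e.functor.obj X).fst = X.fst ∧ (e.functor.obj X).snd = X.snd) ∧
      PreFrobenioid.IsFrobenioid (e.functor ⋙ PreFrobenioid.fiberProductFunctor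
        (𝓕.equiv.functor ⋙ ModelFrobenioid.toElem _ _ (GlobalDivisorData.ofChart c).div)
        (𝓕.baseMor ⋙ 𝓕.identify.functor)) :=
  𝓕.fcirc_isFrobenioid_arithAlong_of_baseCat

/-- The open subgroup `π₁(†𝒟^⊚) ⊆ π₁(†𝒟^⊛)` of t1's interface IS a profinite group (closed in a profinite group),
so the preceding theorem applies to `†𝒟^⊚ := ℬ(π₁(†𝒟^⊚))⁰ = BaseCat (ProfiniteGrp.of N.piDcirc)`.
([IUTchI] Ex 5.1 (i) p.123) [claim: Mochizuki2012, status: disputed] -/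
theorem NFBridgeRecon.compactSpace_piDcirc (N : NFBridgeRecon.{0}) : CompactSpace N.piDcirc :=
  isCompact_iff_compactSpace.mp (N.piDcirc.isClosed.isCompact)

end Literature.IUT.HodgeTheaters

end
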